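import Summits.QuantumFields.YangMills.Theorems.UnitScaleTiltProp8ChartKernelFlatStep
import Summits.QuantumFields.YangMills.Theorems.UnitScaleTiltProp8ChartDoubleBarIterSmall
import HarnessLib

/-!
# Route `UnitScaleTilt`, crux K1 «MinimiserStabilityRegPr» (stmt-QuantumFields-19200), stub V2′ `stub_halvingStep`, C_E node after RULING g26-№6 — (S4′) THE LOG-COORDINATE
# ORBIT OF A SINGLE-BOND PERTURBATION: sizes of the double-bar iterates of a globally small field along `t ↦ e^{iη(Y + t·e_{b₀}M)}` and the identification of the
# abstract orbit `V_0(t) = η(Y + t·e_{b₀}M)`, `V_{m+1} = Φ_m(V_m)` with `−i·log U̿^{(m)}` for `‖t‖·‖ηM‖ ≤ r₀` (the `hV0`∕`hVs` data of ✓`ChartKernelTower.tower_deriv_recursion`)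

Cell `ym3-torus` (HUMAN RULING D-0037: YM₃ on the torus is ladder rung R3, not the Clay problem), width seat `ym-ust-19936-w5` gen 3; `--supports stmt-QuantumFields-19200
--as helper`; def-free, 0 sorry.  ★★OWNER ACK 20 (a): «(S4′) GO».

WHAT.  §1 `norm_expCfg_sub_one_le_of_log`, `norm_eta_smul_add_single_le`, `norm_dbarIterU_expCfg_sub_one_le` (✓B2 `norm_dbarIterU_sub_one_le_two_mul` on the whole torus with ✓B1 as
`hstep`: `‖ηA‖ ≤ r`, `8·3800ℓ²Lᵐ(2r) ≤ 1` ⇒ `‖U̿^{(m)}(e^{iηA}) − 1‖ ≤ 4Lᵐr`), `bondAvgIter_const_smul`; §2 ★ `tower_eq_log` — for `‖ηY‖ ≤ r₀ ≤ 1/20` globally,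
`121600ℓ²L^J r₀ ≤ 1`, every family `V` with `V 0 t = ηY + t•(η e_{b₀}M)` and `V (m+1) t = Φ_m(V m t)` satisfies, for `m ≤ J ≤ m_P + K_P` and `‖t‖·‖ηM‖ ≤ r₀`,
`V m t = −i·log U̿^{(m)}(e^{iη(Y + t e_{b₀}M)})` and every such iterate is within `8Lᵐr₀ < 1` of `1` (round trip ✓`logTower_zero`∕`logTower_succ`).
HONEST SCOPE.  Bookkeeping for the assembly ✓`…ChartKernelFlatAssembly`.  NOT a claim about the stub, the crux, the rung or the mass gap.

References: T. Bałaban, CMP **98** (1985) 17–51 [Balaban1985Averaging] ((131) p.37, (150)–(152) pp.40–41); CMP **102** (1985) 277–309 [Balaban1985Variational] ((152) p.301).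
-/

noncomputable section

open scoped BigOperators Matrix.Norms.L2Operator
open NormedSpace Metric Filter Topology

namespace Summit.QuantumFields.YangMills.Theorems.ChartKernelFlat

open Literature.MathematicalPhysics.QuantumFieldTheory.Balaban1983to89
open T4Continuum BlockAveraging MatrixLog
open LatticeFieldCalculus (bondAvg bondAvgIter)
open B5Eq118OneStroke (iterBlockOf)
open Summit.QuantumFields.YangMills.Theorems.Prop8Chart (isUnit_exp_I_eta expCfg coe_expCfg)
open Summit.QuantumFields.YangMills.Theorems.Prop8ChartDoubleBar
open Summit.QuantumFields.YangMills.Theorems.ChartKernelTube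

variable {P : Params}

/-! ## §1 Sizes along the perturbed field -/

section Sizes

variable {𝔸 : Type*} [NormedRing 𝔸] [NormedAlgebra ℂ 𝔸] [CompleteSpace 𝔸] [NormOneClass 𝔸]

/-- `‖e^{iηA_b} − 1‖ ≤ 2r` when `‖ηA_b‖ ≤ r ≤ 1`. [cite: Balaban1985Variational, (152) p.301] -/
theorem norm_expCfg_sub_one_le_of_log (η : ℝ) (A : PBond P 0 → 𝔸) (b : PBond P 0) {r : ℝ} (hr1 : r ≤ 1) (h : ‖((η : ℂ) • A) b‖ ≤ r) :
    ‖((expCfg η A b : 𝔸ˣ) : 𝔸) - 1‖ ≤ 2 * r := by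
  rw [← expL_smul_eq_expCfg η A]
  exact (norm_coe_expL_sub_one_le ((η : ℂ) • A) b (h.trans hr1)).trans (by linarith)

omit [CompleteSpace 𝔸] [NormOneClass 𝔸] in
/-- the log size of the perturbed field `η(Y + t·e_{b₀}M)` is at most `2r₀` when `‖ηY‖ ≤ r₀` and `‖t‖·‖ηM‖ ≤ r₀`. [folklore] -/
theorem norm_eta_smul_add_single_le (η : ℝ) (Y : PBond P 0 → 𝔸) (b₀ : PBond P 0) (Mdir : 𝔸) {r₀ : ℝ}
    (hY : ∀ b, ‖((η : ℂ) • Y) b‖ ≤ r₀) {t : ℂ} (ht : ‖t‖ * ‖(η : ℂ) • Mdir‖ ≤ r₀) (b : PBond P 0) :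
    ‖((η : ℂ) • (Y + t • (Pi.single b₀ Mdir : PBond P 0 → 𝔸))) b‖ ≤ 2 * r₀ := by
  have h0 : 0 ≤ r₀ := (norm_nonneg _).trans (hY b)
  rw [smul_add, Pi.add_apply]
  refine (norm_add_le _ _).trans ?_
  have h2 : ‖((η : ℂ) • (t • (Pi.single b₀ Mdir : PBond P 0 → 𝔸))) b‖ ≤ r₀ := by
    rw [Pi.smul_apply, Pi.smul_apply]
    by_cases hb : b = b₀
    · subst hb
      rw [Pi.single_eq_same, smul_comm, norm_smul]; exact ht
    · rw [Pi.single_eq_of_ne hb, smul_zero, smul_zero, norm_zero]; exact h0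
  linarith [hY b]

/-- **THE DOUBLE-BAR ITERATES OF A GLOBALLY SMALL FIELD** (✓B2 `norm_dbarIterU_sub_one_le_two_mul` on the whole torus, ✓B1 as its one-step input): if `‖ηA_b‖ ≤ r ≤ 1` for all `b` and
`8·3800·ℓ²·Lᵐ·(2r) ≤ 1`, then `‖U̿^{(m)}(e^{iηA})(e) − 1‖ ≤ 4Lᵐr` at every level-`m` bond `e` (`m ≤ m_P + K_P`). [cite: Balaban1985Averaging, (131) p.37, (89) p.31] -/
theorem norm_dbarIterU_expCfg_sub_one_le (η : ℝ) (A : PBond P 0 → 𝔸) {r : ℝ} (hr0 : 0 ≤ r) (hr1 : r ≤ 1) (hA : ∀ b, ‖((η : ℂ) • A) b‖ ≤ r)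
    {m : ℕ} (hm : m ≤ P.m + P.K) (hbud : 8 * 3800 * (((P.d + 2) * P.L : ℕ) : ℝ) ^ 2 * (P.L : ℝ) ^ m * (2 * r) ≤ 1) (e : PBond P m) :
    ‖((dbarIterU m (expCfg η A) e : 𝔸ˣ) : 𝔸) - 1‖ ≤ 4 * ((P.L : ℝ) ^ m * r) := by
  have h := norm_dbarIterU_sub_one_le_two_mul (P := P) (𝔸 := 𝔸) (C₁ := 3800) (by norm_num)
    (fun j hj S c s hs0 hℓs hS => norm_dbarAvgU_sub_one_le hj c hs0 hℓs hS) hm Set.univ (expCfg η A) (s₀ := 2 * r) (by linarith) hbud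
    (fun b _ _ => norm_expCfg_sub_one_le_of_log η A b hr1 (hA b)) e (Set.mem_univ _) (Set.mem_univ _)
  calc _ ≤ 2 * ((P.L : ℝ) ^ m * (2 * r)) := h
    _ = 4 * ((P.L : ℝ) ^ m * r) := by ring

omit [CompleteSpace 𝔸] [NormOneClass 𝔸] in
/-- ℂ-scalars pass through the iterated straight bond average (✓`bondAvg_const_smul` iterated). [cite: Balaban1984PropagatorsI, (1.18) p.20] -/
theorem bondAvgIter_const_smul (a : ℂ) : ∀ (m : ℕ) (A : PBond P 0 → 𝔸), bondAvgIter m (fun b => a • A b) = fun c => a • bondAvgIter m A c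
  | 0, A => rfl
  | m + 1, A => by
    funext c
    show bondAvg (bondAvgIter m (fun b => a • A b)) c = a • bondAvg (bondAvgIter m A) c
    rw [bondAvgIter_const_smul a m A]
    unfold bondAvg LatticeFieldCalculus.segSum
    simp only [← Finset.smul_sum, smul_comm a]

end Sizes

/-! ## §2 The abstract orbit is the log tower for small `t` -/

section Orbit

variable {𝔸 : Type*} [NormedRing 𝔸] [NormedAlgebra ℂ 𝔸] [CompleteSpace 𝔸] [NormOneClass 𝔸]

/-- **THE ORBIT OF THE AFFINE CURVE `t ↦ η(Y + t·e_{b₀}M)` UNDER THE ONE STEPS `Φ_m` IS `−i·log U̿^{(m)}(e^{iη(Y + t e_{b₀}M)})`** for every `m ≤ J ≤ m_P + K_P` and every `t` with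
`‖t‖·‖ηM‖ ≤ r₀`, provided `‖ηY‖ ≤ r₀ ≤ 1/20` globally and `121600ℓ²·L^J·r₀ ≤ 1`; and every such iterate is within `8Lᵐr₀ (< 1)` of `1` (round trip at every level:
✓`logTower_zero`, ✓`logTower_succ`). [cite: Balaban1985Averaging, (150)-(152) pp.40-41] -/
theorem tower_eq_log (η : ℝ) (Y : PBond P 0 → 𝔸) (b₀ : PBond P 0) (Mdir : 𝔸) {r₀ : ℝ} (hr0 : 0 ≤ r₀) (hr : r₀ ≤ 1 / 20)
    (hY : ∀ b, ‖((η : ℂ) • Y) b‖ ≤ r₀) {J : ℕ} (hJ : J ≤ P.m + P.K)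
    (hbud : 121600 * (((P.d + 2) * P.L : ℕ) : ℝ) ^ 2 * (P.L : ℝ) ^ J * r₀ ≤ 1)
    (V : (m : ℕ) → ℂ → (PBond P m → 𝔸))
    (hV0 : ∀ t, V 0 t = (η : ℂ) • Y + t • ((η : ℂ) • (Pi.single b₀ Mdir : PBond P 0 → 𝔸)))
    (hVs : ∀ m t, V (m + 1) t = fun c => (-Complex.I) • mlog (((dbarAvgU (fun b : PBond P m => (isUnit_exp_I_eta 1 (V m t b)).unit) c : 𝔸ˣ) : 𝔸))) :
    ∀ m, m ≤ J → ∀ t : ℂ, ‖t‖ * ‖(η : ℂ) • Mdir‖ ≤ r₀ →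
      (V m t = fun c => (-Complex.I) • mlog (((dbarIterU m (expCfg η (Y + t • (Pi.single b₀ Mdir : PBond P 0 → 𝔸))) c : 𝔸ˣ) : 𝔸))) ∧
      ∀ e : PBond P m, ‖((dbarIterU m (expCfg η (Y + t • (Pi.single b₀ Mdir : PBond P 0 → 𝔸))) e : 𝔸ˣ) : 𝔸) - 1‖ ≤ 8 * ((P.L : ℝ) ^ m * r₀) := by
  set ℓ : ℝ := (((P.d + 2) * P.L : ℕ) : ℝ) with hℓ
  have hL1 : (1 : ℝ) ≤ P.L := by exact_mod_cast P.L_pos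
  have hℓ1 : (1 : ℝ) ≤ ℓ := by
    rw [hℓ]; exact_mod_cast Nat.one_le_iff_ne_zero.mpr (Nat.mul_ne_zero (by omega) P.L_pos.ne')
  -- sizes of the perturbed field at every level `m ≤ J`
  have hsz : ∀ m, m ≤ J → ∀ t : ℂ, ‖t‖ * ‖(η : ℂ) • Mdir‖ ≤ r₀ →
      ∀ e : PBond P m, ‖((dbarIterU m (expCfg η (Y + t • (Pi.single b₀ Mdir : PBond P 0 → 𝔸))) e : 𝔸ˣ) : 𝔸) - 1‖ ≤ 8 * ((P.L : ℝ) ^ m * r₀) := by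
    intro m hm t ht e
    have hA : ∀ b, ‖((η : ℂ) • (Y + t • (Pi.single b₀ Mdir : PBond P 0 → 𝔸))) b‖ ≤ 2 * r₀ := norm_eta_smul_add_single_le η Y b₀ Mdir hY ht
    have hLm : (P.L : ℝ) ^ m ≤ (P.L : ℝ) ^ J := pow_le_pow_right₀ hL1 hm
    have hbud' : 8 * 3800 * ℓ ^ 2 * (P.L : ℝ) ^ m * (2 * (2 * r₀)) ≤ 1 := by
      have : 8 * 3800 * ℓ ^ 2 * (P.L : ℝ) ^ m * (2 * (2 * r₀)) ≤ 121600 * ℓ ^ 2 * (P.L : ℝ) ^ J * r₀ := by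
        nlinarith [mul_nonneg (mul_nonneg (by positivity : (0 : ℝ) ≤ 8 * 3800 * ℓ ^ 2) (sub_nonneg.2 hLm)) hr0]
      exact this.trans hbud
    have h := norm_dbarIterU_expCfg_sub_one_le η (Y + t • (Pi.single b₀ Mdir : PBond P 0 → 𝔸)) (r := 2 * r₀) (by linarith) (by linarith) hA
      (hm.trans hJ) hbud' e
    calc _ ≤ 4 * ((P.L : ℝ) ^ m * (2 * r₀)) := h
      _ = 8 * ((P.L : ℝ) ^ m * r₀) := by ring
  -- `8 L^m r₀ < 1`
  have hlt1 : ∀ m, m ≤ J → 8 * ((P.L : ℝ) ^ m * r₀) < 1 := by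
    intro m hm
    have hLm : (P.L : ℝ) ^ m * r₀ ≤ (P.L : ℝ) ^ J * r₀ := mul_le_mul_of_nonneg_right (pow_le_pow_right₀ hL1 hm) hr0
    have h0 : 0 ≤ (P.L : ℝ) ^ J * r₀ := by positivity
    have hℓ2 : (1 : ℝ) ≤ ℓ ^ 2 := one_le_pow₀ hℓ1
    have h1 : (P.L : ℝ) ^ J * r₀ ≤ ℓ ^ 2 * ((P.L : ℝ) ^ J * r₀) := by
      have := mul_le_mul_of_nonneg_right hℓ2 h0; linarith
    have hbud' : 121600 * (ℓ ^ 2 * ((P.L : ℝ) ^ J * r₀)) ≤ 1 := by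
      calc 121600 * (ℓ ^ 2 * ((P.L : ℝ) ^ J * r₀)) = 121600 * ℓ ^ 2 * (P.L : ℝ) ^ J * r₀ := by ring
        _ ≤ 1 := hbud
    linarith
  intro m
  induction m with
  | zero =>
    intro _ t ht
    refine ⟨?_, hsz 0 (Nat.zero_le _) t ht⟩
    rw [hV0 t]
    funext c
    have hwin : ‖((η : ℂ) • (Y + t • (Pi.single b₀ Mdir : PBond P 0 → 𝔸))) c‖ ≤ 1 / 5 :=
      (norm_eta_smul_add_single_le η Y b₀ Mdir hY ht c).trans (by linarith)
    rw [logTower_zero η _ c hwin]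
    simp only [smul_add, Pi.add_apply, Pi.smul_apply, smul_comm t (η : ℂ)]
  | succ m ih =>
    intro hm t ht
    have hm' : m ≤ J := Nat.le_of_succ_le hm
    obtain ⟨hVm, hszm⟩ := ih hm' t ht
    refine ⟨?_, hsz (m + 1) hm t ht⟩
    rw [hVs m t, hVm]
    funext c
    have hsmall : ∀ c' : PBond P m, ‖((dbarIterU m (expCfg η (Y + t • (Pi.single b₀ Mdir : PBond P 0 → 𝔸))) c' : 𝔸ˣ) : 𝔸) - 1‖ < 1 :=
      fun c' => (hszm c').trans_lt (hlt1 m hm')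
    exact (logTower_succ m _ hsmall c).symm

end Orbit

end Summit.QuantumFields.YangMills.Theorems.ChartKernelFlat

end
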